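/-
Copyright (c) 2026 the harness21 Literature library. New file (cell pub-hodgecm2, register CR-PORT; author
prover-pub-hodgecm2-b01-g39-0, 2026-08-21), written over the tree ports `CommonReflexHodgeMorphisms` /
`CommonReflexSpan` of the stage-1 package's common-reflex kernel.
-/
import Literature.AlgebraicGeometry.ComplexMultiplication.CommonReflexSpan
import HarnessLib

/-!
# Type inflation along a sub-pair: one pull-back sweeps the eigenline

Let `k : K₀ → F` be a ring map of CM number fields, `Φ₀` a CM type of `K₀` and `Φ₀^F = inducedCMType k Φ₀` the
INDUCED type of `F`; let `(A, ι_A, θ_A)` realise `(K₀, Φ₀)` and `(A', ι', θ')` realise `(F, Φ₀^F)`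
(`ComplexMultiplication.IsCMTypeRealisation`, actions read on `H¹(−; ℂ)`), and let `σ : F → ℂ`.  In the tensor
currency `ℂ ⊗_ℚ H¹(−; ℚ)` with the complexified rational CM actions `complexify (cmAction θ)`:

* `exists_hom_map_eigenline_eq` — **there is ONE morphism `s : A → A'` of the underlying varieties whose complexified
  pull-back `(s^*)_ℂ` maps the `σ`-eigenline of `ℂ ⊗ H¹(A'; ℚ)` ONTO the `σ ∘ k`-eigenline of `ℂ ⊗ H¹(A; ℚ)`**
  (both are lines), granted Riemann's fullness `hR : DeligneMilne1982_Thm_6_20_full` and the model-independence of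
  Hodge types `hI`;
* `exists_hom_eq_pull_of_mem_eigenline` — pointwise form: every `σ ∘ k`-eigenvector `α₀` of `A` is `(s^*)_ℂ α` for a
  `σ`-eigenvector `α` of `A'`;
* `eigenline_complexify_comp_ringEquiv`, `exists_hom_map_eigenline_eq_coded`, `exists_hom_eq_pull_of_mem_eigenline_coded`
  — the same with BOTH realisations given over CODE FIELDS `e₀ : K₀ ≃+* E₀`, `e : F ≃+* E` and the CM types given by
  membership clauses (`τ ∈ Φ_{E₀} ↔ τ ∘ e₀ ∈ Φ₀`, `τ ∈ Φ_E ↔ τ ∘ e ∘ k ∈ Φ₀`), the actions being `cmAction (θ₀ ∘ e₀)`,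
  `cmAction (θ ∘ e)` — the shape in which a model universe's `cmAV K Φ` (a chosen realisation of a coded CM type
  acting through `K ≃ E`) presents its eigenlines `Universe.eigenLine K Φ σ` (by `rfl`, `eigenline_complexify_eq`).

Proof of the first: `H¹(A; ℚ)` is a `K₀`-line, so there are finitely many `K₀`-equivariant coordinate maps
`λ_l : H¹(A'; ℚ) → H¹(A; ℚ)` (for the restricted action `θ' ∘ k` on the source) with `⋂ ker λ_l = 0`
(`exists_cmLinear_family_injective`); each is a weight-one Hodge morphism (`commonReflex_isHodgeMorphismOne` with
`k₁ = k`, `k₂ = id`), so fullness gives `r_l : A → A'` with `r_l^* = n_l λ_l`, `n_l ≥ 1`; over `ℂ` the `(r_l^*)_ℂ` are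
jointly injective and `K₀`-equivariant, hence carry the `σ`-LINE of `A'` into the `σ ∘ k`-LINE of `A`
(`map_mem_eigenline_comp`), and for some `l` the image of a nonzero `σ`-eigenvector is nonzero, so that `(r_l^*)_ℂ`
maps line onto line.  (This is the `m = 1`, "one slot" reading of (L2) `eigenline_le_span_pull_eigenline`: on the SMALL
side the eigenline is one-dimensional, so one pull-back suffices and no sum over morphisms is needed.)

SOURCES.  Cohomological form of Shimura's type-inflation theorem — an abelian variety of the induced type
`(F; {φ_i})` is isomorphic to a product of `[F:K₀]` complex tori of type `(K₀; {ψ_j})`, so that `A'` and `A^{[F:K₀]}`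
are isogenous compatibly with `K₀` ([Shimura1998] §6.2 Theorem 3, pp. 41–43; [Deligne1982HodgeCycles] §5 p. 63,
`B_α = A_α ⊗_{E_α} E`, with Example 3.7 for the Hodge structure of a CM abelian variety) — with the morphisms supplied
by Riemann's theorem ([DeligneMilne1982Tannakian] §6 Thm. 6.20).

USE (pub-hodgecm2, junction B01, ROUTES-B01 §7 L1-C/L2-B): the `GeneratorInflation` property of the model universe
of record — a pull-back `G^* α₀` of a holomorphic `σ ∘ k`-eigen one-form of `A_{(K₀,Φ₀)}` along `G : P_Γ → A_{(K₀,Φ₀)}`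
is the pull-back `(G ≫ s)^* α` of a holomorphic `σ`-eigen one-form of `A_{(F,Φ₀^F)}` — is
`exists_hom_eq_pull_of_mem_eigenline_coded` followed by `BettiUniverse.pull_comp`; the universe-side dictionary
(`cmCodeEquiv`, `universeOf_fact_alphaLine`) is not this file's.  Theorems only; no definitions, no named facts;
nothing of PerL / [QW8] / the 2001 programme is used or asserted.
-/

noncomputable section

open scoped TensorProduct
open NumberField CategoryTheory Module

namespace Literature.AlgebraicGeometry.ComplexMultiplication.CommonReflex

open Literature.AlgebraicGeometry.Motives (SchemeOver IsSmoothProjective CMType AbelianVariety bettiCohomology)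
open Literature.AlgebraicGeometry.HodgeTheory (complexBetti hodgePQ_independent_of_hodgeModel
  DeligneMilne1982_Thm_6_20_full)
open Literature.AlgebraicGeometry.HodgeTheory.BettiUniverse (pull pull_comp cmAction IsInducedOnIntegers
  finrank_bettiCohomology_eq)
open Literature.AlgebraicGeometry.ComplexMultiplication
open Literature.NumberTheory.Automorphic.PicardCM (eigenline)
open Literature.NumberTheory.ComplexMultiplication (inducedCMType mem_inducedCMType_iff inducedCMType_id)

/-! ## 1. Literal realisations -/

section Literal

variable {K₀ F : Type} [Field K₀] [NumberField K₀] [Field F] [NumberField F]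
  (k : K₀ →+* F) {Φ₀ : CMType K₀}
  {A : AbelianVariety ℂ} {ιA : 𝓞 K₀ →+* End A} {θA : K₀ →+* Module.End ℂ (complexBetti A.X 1)}
  {A' : AbelianVariety ℂ} {ιA' : 𝓞 F →+* End A'} {θA' : F →+* Module.End ℂ (complexBetti A'.X 1)}

/-- **One pull-back sweeps the eigenline.**  `(A, ι_A, θ_A)` realises `(K₀, Φ₀)`, `(A', ι', θ')` realises the
induced type `(F, Φ₀^F)` along `k : K₀ → F`, `σ : F → ℂ`.  Then there is a morphism `s : A → A'` of the underlying
varieties with `(s^*)_ℂ (ℂ ⊗ H¹(A'; ℚ))_σ = (ℂ ⊗ H¹(A; ℚ))_{σ ∘ k}` (eigenlines of the complexified rational CM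
actions), granted Riemann's fullness `hR` and `hI`.  Cohomological form of the type-inflation theorem
(`A' ∼ A ⊗_{K₀} F`). [cite: Shimura1998, §6.2 Theorem 3 (pp. 41–43)]
[cite: Deligne1982HodgeCycles, §5 p. 63 and §3 Example 3.7] [cite: DeligneMilne1982Tannakian, §6 Thm. 6.20 (Riemann)] -/
theorem exists_hom_map_eigenline_eq (hR : DeligneMilne1982_Thm_6_20_full)
    (hI : hodgePQ_independent_of_hodgeModel)
    (hA : IsCMTypeRealisation Φ₀ A ιA θA) (hA' : IsCMTypeRealisation (inducedCMType k Φ₀) A' ιA' θA')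
    (hθA : IsInducedOnIntegers θA) (hθA' : IsInducedOnIntegers θA') (σ : F →+* ℂ) :
    ∃ s : A.X ⟶ A'.X,
      Submodule.map ((pull s 1).baseChange ℂ) (eigenline (complexify (cmAction θA' hθA')) σ) =
        eigenline (complexify (cmAction θA hθA)) (σ.comp k) := by
  classical
  haveI := finite_bettiCohomology_of_realisation hA
  haveI := finite_bettiCohomology_of_realisation hA'
  -- (1) `λ_l : H¹(A'; ℚ) → H¹(A; ℚ)`, `K₀`-equivariant for `θ' ∘ k`, `θ`, jointly injective
  have hV : Module.finrank ℚ (bettiCohomology A.X 1) = Module.finrank ℚ K₀ := by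
    rw [finrank_bettiCohomology_eq hA.1 1, hA.2.1]
  obtain ⟨m', lam, hinj, hequiv⟩ := exists_cmLinear_family_injective (cmAction θA hθA)
    ((cmAction θA' hθA').comp k.toRatAlgHom) hV
  have hequiv' : ∀ (l : Fin m') (a : K₀) (v : bettiCohomology A'.X 1),
      lam l (cmAction θA' hθA' (k a) v) = cmAction θA hθA ((RingHom.id K₀) a) (lam l v) := fun l a v ↦ by
    simpa using hequiv l a v
  -- (2) each `λ_l` is Hodge (common reflex `K₀ → F`, `K₀ → K₀`), so `r_l^* = n_l • λ_l` for some `r_l : A ⟶ A'`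
  have hA₀ : IsCMTypeRealisation (inducedCMType (RingHom.id K₀) Φ₀) A ιA θA := by
    rw [inducedCMType_id]; exact hA
  have hfull := fun l : Fin m' ↦ hR A A' (lam l) hA'.nonempty_hodgeModel_dim
    (commonReflex_isHodgeMorphismOne k (RingHom.id K₀) hI hA' hA₀ hθA' hθA (lam l) (hequiv' l))
  choose r n hn hr using hfull
  -- (3) the complex picture: `R_l := (r_l^*)_ℂ`, equivariant and jointly injective
  let Rl : Fin m' → (ℂ ⊗[ℚ] bettiCohomology A'.X 1 →ₗ[ℂ] ℂ ⊗[ℚ] bettiCohomology A.X 1) :=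
    fun l ↦ (pull (r l).hom.hom.hom 1).baseChange ℂ
  have hrl : ∀ (l : Fin m') (v : bettiCohomology A'.X 1), pull (r l).hom.hom.hom 1 v = n l • lam l v :=
    fun l v ↦ hr l v
  have hRl : ∀ (l : Fin m') (a : K₀) (c : ℂ ⊗[ℚ] bettiCohomology A'.X 1),
      Rl l (complexify (cmAction θA' hθA') (k a) c) = complexify (cmAction θA hθA) a (Rl l c) :=
    fun l a c ↦ baseChange_complexify_apply (cmAction θA' hθA') (cmAction θA hθA) (pull (r l).hom.hom.hom 1)
      (fun v ↦ by rw [hrl, hrl, map_nsmul, hequiv' l a v, RingHom.id_apply]) c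
  have hRinj : ∀ c : ℂ ⊗[ℚ] bettiCohomology A'.X 1, (∀ l, Rl l c = 0) → c = 0 := by
    intro c hc
    refine eq_zero_of_forall_baseChange_eq_zero lam hinj c fun l ↦ ?_
    have hnl : (pull (r l).hom.hom.hom 1) = (n l : ℚ) • lam l := by
      refine LinearMap.ext fun v ↦ ?_
      rw [hrl, LinearMap.smul_apply, Nat.cast_smul_eq_nsmul]
    have h0 := hc l
    simp only [Rl, hnl, LinearMap.baseChange_smul, LinearMap.smul_apply] at h0
    exact (smul_eq_zero.1 h0).resolve_left (by exact_mod_cast (hn l).ne')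
  -- (4) a nonzero `σ`-eigenvector `β` of `A'`; some `R_l β ≠ 0`, a `σ ∘ k`-eigenvector of `A`
  have hne : eigenline (complexify (cmAction θA' hθA')) σ ≠ ⊥ := by
    intro hbot
    have h1 := finrank_eigenline_complexify_eq_one hA' hθA' σ
    rw [hbot, finrank_bot] at h1
    exact zero_ne_one h1
  obtain ⟨β, hβ, hβ0⟩ := Submodule.exists_mem_ne_zero_of_ne_bot hne
  obtain ⟨l, hl⟩ : ∃ l, Rl l β ≠ 0 := by
    by_contra h
    push Not at h
    exact hβ0 (hRinj β h)
  have hlk : Rl l β ∈ eigenline (complexify (cmAction θA hθA)) (σ.comp k) :=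
    map_mem_eigenline_comp k (Rl l) (hRl l) hβ
  -- (5) `R_l` maps the `σ`-line into the `σ ∘ k`-line, onto since the latter is a line containing `R_l β ≠ 0`
  refine ⟨(r l).hom.hom.hom, le_antisymm ?_ ?_⟩
  · rw [Submodule.map_le_iff_le_comap]
    intro β' hβ'
    exact map_mem_eigenline_comp k (Rl l) (hRl l) hβ'
  · intro x hx
    obtain ⟨e, he⟩ : ∃ e : ℂ, e • Rl l β = x := by
      have h1 := (finrank_eq_one_iff_of_nonzero' (⟨Rl l β, hlk⟩ : eigenline (complexify (cmAction θA hθA)) (σ.comp k))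
        (by simpa [ne_eq, Submodule.mk_eq_zero] using hl)).1 (finrank_eigenline_complexify_eq_one hA hθA (σ.comp k))
        ⟨x, hx⟩
      obtain ⟨e, he⟩ := h1
      exact ⟨e, by simpa using congrArg Subtype.val he⟩
    refine ⟨e • β, Submodule.smul_mem _ e hβ, ?_⟩
    rw [map_smul]
    exact he

/-- **Pointwise form**: every `σ ∘ k`-eigenvector `α₀ ∈ ℂ ⊗ H¹(A; ℚ)` of the SMALL realisation is the pull-back
`(s^*)_ℂ α` of a `σ`-eigenvector `α ∈ ℂ ⊗ H¹(A'; ℚ)` of the realisation of the induced type, along ONE morphism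
`s : A → A'` (independent of `α₀`). [cite: Shimura1998, §6.2 Theorem 3 (pp. 41–43)]
[cite: Deligne1982HodgeCycles, §5 p. 63 and §3 Example 3.7] [cite: DeligneMilne1982Tannakian, §6 Thm. 6.20 (Riemann)] -/
theorem exists_hom_eq_pull_of_mem_eigenline (hR : DeligneMilne1982_Thm_6_20_full)
    (hI : hodgePQ_independent_of_hodgeModel)
    (hA : IsCMTypeRealisation Φ₀ A ιA θA) (hA' : IsCMTypeRealisation (inducedCMType k Φ₀) A' ιA' θA')
    (hθA : IsInducedOnIntegers θA) (hθA' : IsInducedOnIntegers θA') (σ : F →+* ℂ) :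
    ∃ s : A.X ⟶ A'.X, ∀ α₀ ∈ eigenline (complexify (cmAction θA hθA)) (σ.comp k),
      ∃ α ∈ eigenline (complexify (cmAction θA' hθA')) σ, (pull s 1).baseChange ℂ α = α₀ := by
  obtain ⟨s, hs⟩ := exists_hom_map_eigenline_eq k hR hI hA hA' hθA hθA' σ
  refine ⟨s, fun α₀ hα₀ ↦ ?_⟩
  rw [← hs] at hα₀
  obtain ⟨α, hα, rfl⟩ := hα₀
  exact ⟨α, hα, rfl⟩

end Literal

/-! ## 2. Realisations over code fields -/

section Coded

variable {K₀ F E₀ E : Type} [Field K₀] [NumberField K₀] [Field F] [NumberField F]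
  [Field E₀] [NumberField E₀] [Field E] [NumberField E]
  (k : K₀ →+* F) {Φ₀ : CMType K₀}
  {A : AbelianVariety ℂ} {ι₀ : 𝓞 E₀ →+* End A} {θ₀ : E₀ →+* Module.End ℂ (complexBetti A.X 1)}
  {A' : AbelianVariety ℂ} {ι : 𝓞 E →+* End A'} {θ : E →+* Module.End ℂ (complexBetti A'.X 1)}

/-- **Eigenlines under transport of the acting field** `e : K ≃+* K'`: the `σ`-eigenline of the action
`cmAction (θ ∘ e)` of `K` is the `σ ∘ e⁻¹`-eigenline of the action `cmAction θ` of `K'` (`cmAction_comp_ringEquiv`).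
[cite: Shimura1998, §5.2 (pp. 36–37)] -/
theorem eigenline_complexify_comp_ringEquiv {X : SchemeOver ℂ}
    (θX : E →+* Module.End ℂ (complexBetti X 1)) (hθX : IsInducedOnIntegers θX)
    (e : K₀ ≃+* E) (h' : IsInducedOnIntegers (θX.comp e.toRingHom)) (σ : K₀ →+* ℂ) :
    eigenline (complexify (cmAction (θX.comp e.toRingHom) h')) σ =
      eigenline (complexify (cmAction θX hθX)) (σ.comp e.symm.toRingHom) := by
  ext t
  rw [mem_eigenline_complexify_iff, mem_eigenline_complexify_iff]
  constructor
  · intro h b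
    have hb := h (e.symm b)
    rw [cmAction_comp_ringEquiv θX hθX e h' (e.symm b), RingEquiv.apply_symm_apply] at hb
    rw [hb]
    rfl
  · intro h a
    have ha := h (e a)
    rw [cmAction_comp_ringEquiv θX hθX e h' a, ha, RingHom.comp_apply]
    simp

/-- **One pull-back sweeps the eigenline — coded realisations.**  `e₀ : K₀ ≃+* E₀`, `e : F ≃+* E` code fields;
`(A, ι₀, θ₀)` realises the CM type `Φ_{E₀}` of `E₀` corresponding to `Φ₀` (`τ ∈ Φ_{E₀} ↔ τ ∘ e₀ ∈ Φ₀`), and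
`(A', ι, θ)` realises the CM type `Φ_E` of `E` corresponding to `Φ₀^F` (`τ ∈ Φ_E ↔ τ ∘ e ∘ k ∈ Φ₀`); the `K₀`- and
`F`-indexed actions are `cmAction (θ₀ ∘ e₀)`, `cmAction (θ ∘ e)`.  Then some `s : A → A'` has
`(s^*)_ℂ (ℂ ⊗ H¹(A'; ℚ))_σ = (ℂ ⊗ H¹(A; ℚ))_{σ ∘ k}` for every `σ : F → ℂ`.
[cite: Shimura1998, §6.2 Theorem 3 (pp. 41–43)] [cite: Deligne1982HodgeCycles, §5 p. 63 and §3 Example 3.7]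
[cite: DeligneMilne1982Tannakian, §6 Thm. 6.20 (Riemann)] -/
theorem exists_hom_map_eigenline_eq_coded (hR : DeligneMilne1982_Thm_6_20_full)
    (hI : hodgePQ_independent_of_hodgeModel)
    (e₀ : K₀ ≃+* E₀) {Φ₀' : CMType E₀} (hΦ₀' : ∀ τ : E₀ →+* ℂ, τ ∈ Φ₀'.1 ↔ τ.comp e₀.toRingHom ∈ Φ₀.1)
    (hA : IsCMTypeRealisation Φ₀' A ι₀ θ₀) (hθ₀ : IsInducedOnIntegers (θ₀.comp e₀.toRingHom))
    (e : F ≃+* E) {Φ' : CMType E} (hΦ' : ∀ τ : E →+* ℂ, τ ∈ Φ'.1 ↔ (τ.comp e.toRingHom).comp k ∈ Φ₀.1)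
    (hA' : IsCMTypeRealisation Φ' A' ι θ) (hθ : IsInducedOnIntegers (θ.comp e.toRingHom)) (σ : F →+* ℂ) :
    ∃ s : A.X ⟶ A'.X,
      Submodule.map ((pull s 1).baseChange ℂ) (eigenline (complexify (cmAction (θ.comp e.toRingHom) hθ)) σ) =
        eigenline (complexify (cmAction (θ₀.comp e₀.toRingHom) hθ₀)) (σ.comp k) := by
  -- the sub-pair read on the code fields: `k' = e ∘ k ∘ e₀⁻¹ : E₀ → E`, `Φ' = (Φ₀')^{E}` along `k'`
  let k' : E₀ →+* E := e.toRingHom.comp (k.comp e₀.symm.toRingHom)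
  have hΦ'' : Φ' = inducedCMType k' Φ₀' := by
    apply Subtype.ext
    ext τ
    rw [hΦ', mem_inducedCMType_iff, hΦ₀']
    constructor <;> intro h <;> convert h using 2 <;> ext x <;> simp [k']
  have hA'' : IsCMTypeRealisation (inducedCMType k' Φ₀') A' ι θ := by
    rw [← hΦ'']; exact hA'
  obtain ⟨s, hs⟩ := exists_hom_map_eigenline_eq k' hR hI hA hA'' hA.isInducedOnIntegers hA'.isInducedOnIntegers
    (σ.comp e.symm.toRingHom)
  refine ⟨s, ?_⟩
  rw [eigenline_complexify_comp_ringEquiv θ hA'.isInducedOnIntegers e hθ σ,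
    eigenline_complexify_comp_ringEquiv θ₀ hA.isInducedOnIntegers e₀ hθ₀ (σ.comp k), hs]
  congr 1
  ext x
  simp [k']

/-- **Pointwise coded form** (the `GeneratorInflation` step of a model universe): every `σ ∘ k`-eigenvector `α₀` of
the coded realisation of `(K₀, Φ₀)` is `(s^*)_ℂ α` for a `σ`-eigenvector `α` of the coded realisation of `(F, Φ₀^F)`,
along ONE morphism `s : A → A'`. [cite: Shimura1998, §6.2 Theorem 3 (pp. 41–43)]
[cite: Deligne1982HodgeCycles, §5 p. 63 and §3 Example 3.7] [cite: DeligneMilne1982Tannakian, §6 Thm. 6.20 (Riemann)] -/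
theorem exists_hom_eq_pull_of_mem_eigenline_coded (hR : DeligneMilne1982_Thm_6_20_full)
    (hI : hodgePQ_independent_of_hodgeModel)
    (e₀ : K₀ ≃+* E₀) {Φ₀' : CMType E₀} (hΦ₀' : ∀ τ : E₀ →+* ℂ, τ ∈ Φ₀'.1 ↔ τ.comp e₀.toRingHom ∈ Φ₀.1)
    (hA : IsCMTypeRealisation Φ₀' A ι₀ θ₀) (hθ₀ : IsInducedOnIntegers (θ₀.comp e₀.toRingHom))
    (e : F ≃+* E) {Φ' : CMType E} (hΦ' : ∀ τ : E →+* ℂ, τ ∈ Φ'.1 ↔ (τ.comp e.toRingHom).comp k ∈ Φ₀.1)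
    (hA' : IsCMTypeRealisation Φ' A' ι θ) (hθ : IsInducedOnIntegers (θ.comp e.toRingHom)) (σ : F →+* ℂ) :
    ∃ s : A.X ⟶ A'.X, ∀ α₀ ∈ eigenline (complexify (cmAction (θ₀.comp e₀.toRingHom) hθ₀)) (σ.comp k),
      ∃ α ∈ eigenline (complexify (cmAction (θ.comp e.toRingHom) hθ)) σ, (pull s 1).baseChange ℂ α = α₀ := by
  obtain ⟨s, hs⟩ := exists_hom_map_eigenline_eq_coded k hR hI e₀ hΦ₀' hA hθ₀ e hΦ' hA' hθ σ
  refine ⟨s, fun α₀ hα₀ ↦ ?_⟩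
  rw [← hs] at hα₀
  obtain ⟨α, hα, rfl⟩ := hα₀
  exact ⟨α, hα, rfl⟩

end Coded

end Literature.AlgebraicGeometry.ComplexMultiplication.CommonReflex

end
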